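import Summits.HodgeConjecture.CorCM.Census.HalfParityFloor
import Summits.HodgeConjecture.CorCM.Census.HalfParityBounds
import Summits.HodgeConjecture.CorCM.Census.CoinvariantSplitCyclic
import Summits.HodgeConjecture.CorCM.FaceCoinvariantOddHalf
import HarnessLib

/-!
# The face HALF-PARITY floor: `β(F) − 1 − δ(F) + t(F) ≤ φ₂(F) ≤ |𝒮|` for every Galois CM field and every `hgen` set of faces

COR-CM (cell `pub-hodgecm2`), count-neutral kernel combinatorics by the binder seat b09 (gen 30; lane HALF-PARITY-LAW, André-3's
ask A6-R52), part IV: the intrinsic form, for a Galois CM field `F`, of `Census/HalfParity.lean` (I) and `Census/HalfParityFloor.lean`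
(III); sibling of `CorCM/FaceParityFloor.lean` (gen 28) and `CorCM/FaceCoinvariantFloor.lean` (gen 29).  Theorems only; no `decide`,
no certificate, no named fact, no `sorry`; `Interfaces.lean` (C1), every E term, B01, `Transposition/*` untouched.  HONEST FRAMING:
`HC_CM` is NOT proved, here or anywhere in the tree; nothing here is a period.  T5: n/a-class — the one Prop binder is the generation
binder `hgen(𝒮, σ₀)` of INT2-GEN (`CorCM/FacePeriodsGeneratingSet.lean`), inhabited by `FaceBasis.basisFace_hgen`; no named-fact /
conjecture-def binder; checker: self (prover-pub-hodgecm2-b09-g30-0), 2026-08-22.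

SETTING.  `F` a Galois CM field, `G = GalT F`, `c = conjT` (central), `φ₂(F) = fibreTwo conjT conjT_mul_self` the coinvariant fibre,
`β(F)` the number of blocks (simple CM isogeny classes split by `F`), `δ(F) = wdelta conjT T₀`, and the NEW invariant
**`t(F) := halfRank conjT conjT_mul_self`** of part III = the number of admissible half-parity classes on the Hodge lattice of `F`
mod `2` that are independent of the block parities.  DICTIONARY (informal, not formalised): an index-two subgroup `H ∋ conjT` of
`Gal(F/ℚ)` is `Gal(F/k)` for a REAL quadratic subfield `k ⊂ F⁺ ⊂ F`; a block `b` (an isogeny class of simple CM abelian varieties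
`B` with CM by the subfield `E_b ⊂ F` cut out by the stabiliser) is admissible for `H` iff `k ⊂ E_b`; the half-parity of
`(R, H)` counts, mod `2`, the multiplicity of the factors `B ∈ R` read through the embeddings of `E_b` lying over ONE of the two
embeddings of `k` [cite: Milne1999, Prop. 2.1, p. 54] [cite: Pohlmann1968, Thm 1].

CONTENT.
* §1 **THE FACE HALF-PARITY FLOOR** (`card_block_add_halfRank_le_fibreTwo_add`, `card_block_add_halfRank_le_card_add_of_hgen`):
  **`β(F) + t(F) ≤ φ₂(F) + 1 + δ(F) ≤ |𝒮| + 1 + δ(F)`** for every finite `𝒮 ⊆ Face F` with `hgen(𝒮, σ₀)` — every degree, every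
  Galois type, no census.  André-3's LAW (58/58 Galois CM types of order `≤ 24`): the first `≤` is an equality.
* §2 **Witness form** (`card_block_le_card_add_of_hgen_of_witness`): ONE admissible half-block set `A` with a Hodge vector `x` mod `2`
  of vanishing block parities and `hsum A x ≠ 0` already gives `β(F) ≤ |𝒮| + δ(F)` — the parity floor plus one (`Q₈`-, `Q₁₆`-,
  `SD₁₆`-, `M₁₆`-, `Dic₆`-, `ℤ/3×Q₈`-, `ℤ/4×S₃`-fields …).
* §3 **VANISHING** (`halfRank_eq_zero_of_isCyclic`, `_of_odd_finrank_div_two`, `_of_split`): `t(F) = 0` for cyclic `Gal(F/ℚ)`, for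
  `[F:ℚ]/2` odd, and for split-cyclic `Gal(F/ℚ) = ⟨g⟩ ⊔ conj·⟨g⟩` (`ord g` even) — there every admissible half-parity is a parity
  combination on the Hodge lattice (gen 29's closed forms `φ₂ = β − 1`, `β − 1`, `β − 2`).

## References
* [Pohlmann1968] H. Pohlmann, Algebraic cycles on abelian varieties of complex multiplication type, Ann. of Math. 88 (1968), Thm 1.
* [Milne1999] J. S. Milne, Lefschetz motives and the Tate conjecture, Compositio Math. 117 (1999), Prop. 2.1, p. 54.
-/

noncomputable section

open NumberField NumberField.ComplexEmbedding

namespace Summit.HodgeConjecture.CorCM.FaceHalfParity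

open Literature.AlgebraicGeometry.Motives (CMType)
open Summit.HodgeConjecture.CorCM.Prior.AllgGroup.RfwfAllgGroup
open Summit.HodgeConjecture.CorCM.Census.BlockParity
open Summit.HodgeConjecture.CorCM.Census.Coinvariant
open Summit.HodgeConjecture.CorCM.Census.HalfParity

variable {F : Type} [Field F] [NumberField F]

/-! ## §1 The face half-parity floor -/

/-- **`β(F) + t(F) ≤ φ₂(F) + 1 + δ(F)`** for every Galois CM field (part III for `(GalT F, conjT)`). [folklore] -/
theorem card_block_add_halfRank_le_fibreTwo_add [IsCMField F] [IsGalois ℚ F] (T₀ : CMF (GalT F) conjT) :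
    Fintype.card (Block (conjT : GalT F)) + halfRank (conjT : GalT F) conjT_mul_self ≤
      fibreTwo (conjT : GalT F) conjT_mul_self + 1 + wdelta (conjT : GalT F) T₀ :=
  Census.HalfParity.card_block_add_halfRank_le_fibreTwo_add conjT conjT_mul_self T₀

/-- `δ`-free form: `β(F) + t(F) ≤ φ₂(F) + 2`. [folklore] -/
theorem card_block_add_halfRank_le_fibreTwo_add_two [IsCMField F] [IsGalois ℚ F] :
    Fintype.card (Block (conjT : GalT F)) + halfRank (conjT : GalT F) conjT_mul_self ≤
      fibreTwo (conjT : GalT F) conjT_mul_self + 2 :=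
  Census.HalfParity.card_block_add_halfRank_le_fibreTwo_add_two conjT conjT_mul_self conjT_ne_one

/-- **THE FACE HALF-PARITY FLOOR.**  For a Galois CM field `F` and ANY finite set `𝒮` of faces satisfying the generation binder
`hgen(𝒮, σ₀)` of INT2-GEN: **`β(F) + t(F) ≤ |𝒮| + 1 + δ(F)`**, i.e. `|𝒮| ≥ β(F) − 1 − δ(F) + t(F)` — no census, every degree and
every Galois type. [folklore] -/
theorem card_block_add_halfRank_le_card_add_of_hgen [IsCMField F] [IsGalois ℚ F] (T₀ : CMF (GalT F) conjT)
    (𝒮 : Finset (Face F)) (σ₀ : F →+* ℂ)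
    (hgen : ∀ f : Face F, lefChar f.corner (fun _ => ({σ₀} : Finset (F →+* ℂ))) ∈ AddSubgroup.closure
      {a : Asym F | ∃ g ∈ (𝒮 : Set (Face F)), ∃ σ : F →+* ℂ, a = lefChar g.corner (fun _ => ({σ} : Finset (F →+* ℂ)))}) :
    Fintype.card (Block (conjT : GalT F)) + halfRank (conjT : GalT F) conjT_mul_self ≤
      𝒮.card + 1 + wdelta (conjT : GalT F) T₀ := by
  have h1 := card_block_add_halfRank_le_fibreTwo_add T₀
  have h2 := FaceCoinvariant.fibreTwo_le_card_of_hgen 𝒮 σ₀ hgen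
  omega

/-! ## §2 Witness form -/

/-- **One new half-parity raises the face floor by one**: an admissible half-block set `A` of `(GalT F, conjT)` with a Hodge vector
`x` mod `2` of vanishing block parities and `hsum A x ≠ 0` gives `β(F) ≤ φ₂(F) + δ(F)`. [folklore] -/
theorem card_block_le_fibreTwo_add_of_witness [IsCMField F] [IsGalois ℚ F] (T₀ : CMF (GalT F) conjT)
    {A : Finset (CMF (GalT F) conjT)} (hA : A ∈ admHalves (conjT : GalT F) conjT_mul_self)
    {x : CMF (GalT F) conjT →₀ ZMod 2} (hx : x ∈ hodge2 (conjT : GalT F) conjT_mul_self) (hpx : par2 (conjT : GalT F) x = 0)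
    (hAx : hsum (conjT : GalT F) A x ≠ 0) :
    Fintype.card (Block (conjT : GalT F)) ≤ fibreTwo (conjT : GalT F) conjT_mul_self + wdelta (conjT : GalT F) T₀ :=
  Census.HalfParity.card_block_le_fibreTwo_add_of_witness conjT conjT_mul_self T₀ hA hx hpx hAx

/-- … and with an `hgen` set of faces: **`β(F) ≤ |𝒮| + δ(F)`**. [folklore] -/
theorem card_block_le_card_add_of_hgen_of_witness [IsCMField F] [IsGalois ℚ F] (T₀ : CMF (GalT F) conjT)
    {A : Finset (CMF (GalT F) conjT)} (hA : A ∈ admHalves (conjT : GalT F) conjT_mul_self)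
    {x : CMF (GalT F) conjT →₀ ZMod 2} (hx : x ∈ hodge2 (conjT : GalT F) conjT_mul_self) (hpx : par2 (conjT : GalT F) x = 0)
    (hAx : hsum (conjT : GalT F) A x ≠ 0) (𝒮 : Finset (Face F)) (σ₀ : F →+* ℂ)
    (hgen : ∀ f : Face F, lefChar f.corner (fun _ => ({σ₀} : Finset (F →+* ℂ))) ∈ AddSubgroup.closure
      {a : Asym F | ∃ g ∈ (𝒮 : Set (Face F)), ∃ σ : F →+* ℂ, a = lefChar g.corner (fun _ => ({σ} : Finset (F →+* ℂ)))}) :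
    Fintype.card (Block (conjT : GalT F)) ≤ 𝒮.card + wdelta (conjT : GalT F) T₀ := by
  have h1 := card_block_le_fibreTwo_add_of_witness T₀ hA hx hpx hAx
  have h2 := FaceCoinvariant.fibreTwo_le_card_of_hgen 𝒮 σ₀ hgen
  omega

/-! ## §3 Vanishing of `t(F)` -/

/-- **Cyclic Galois group: `t(F) = 0`** (`φ₂(F) = β(F) − 1` is the parity rank). [folklore] -/
theorem halfRank_eq_zero_of_isCyclic [IsCMField F] [IsGalois ℚ F] [IsCyclic (GalT F)] :
    halfRank (conjT : GalT F) conjT_mul_self = 0 :=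
  halfRank_eq_zero_of_fibreTwo_eq conjT conjT_mul_self
    (Census.Coinvariant.fibreTwo_eq_finrank_span_par_of_isCyclic conjT conjT_mul_self conjT_ne_one)

/-- **Degree `2·odd`: `t(F) = 0`.** [folklore] -/
theorem halfRank_eq_zero_of_odd_finrank_div_two [IsCMField F] [IsGalois ℚ F] (hodd : Odd (Module.finrank ℚ F / 2)) :
    halfRank (conjT : GalT F) conjT_mul_self = 0 :=
  halfRank_eq_zero_of_fibreTwo_eq conjT conjT_mul_self (FaceCoinvariant.fibreTwo_eq_finrank_span_par_of_odd_finrank_div_two hodd)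

/-- **Split-cyclic Galois group `⟨g⟩ ⊔ conj·⟨g⟩`, `ord g` even: `t(F) = 0`.** [folklore] -/
theorem halfRank_eq_zero_of_split [IsCMField F] [IsGalois ℚ F] {g : GalT F}
    (hcov : ∀ Q : GalT F, (∃ k : ℕ, Q = g ^ k) ∨ ∃ k : ℕ, Q = conjT * g ^ k) (hng : ∀ k : ℕ, (conjT : GalT F) ≠ g ^ k)
    (hm : Even (orderOf g)) : halfRank (conjT : GalT F) conjT_mul_self = 0 :=
  halfRank_eq_zero_of_fibreTwo_eq conjT conjT_mul_self
    (Census.Coinvariant.fibreTwo_eq_finrank_span_par_of_split conjT conjT_mul_self conjT_ne_one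
      (fun P => FaceBasis.conjT_comm P) hcov hng hm)


/-! ## §4 Appendix (gen 30, same session): the intrinsic sandwich for `F` -/

/-- **`t(F) ≤ (1 + δ(F)) · h(F)`**, `h(F) = hTwo conjT` = the number of index-two subgroups of `Gal(F/ℚ)` containing complex
conjugation (= the number of real quadratic subfields of `F`). [folklore] -/
theorem halfRank_le_hTwo [IsCMField F] [IsGalois ℚ F] (T₀ : CMF (GalT F) conjT) :
    halfRank (conjT : GalT F) conjT_mul_self ≤ (1 + wdelta (conjT : GalT F) T₀) * hTwo (conjT : GalT F) :=
  Census.HalfParity.halfRank_le_hTwo conjT conjT_mul_self T₀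

/-- **No real quadratic subfield (`h(F) = 0`) ⇒ `t(F) = 0`.** [folklore] -/
theorem halfRank_eq_zero_of_hTwo_eq_zero [IsCMField F] [IsGalois ℚ F] (h : hTwo (conjT : GalT F) = 0) :
    halfRank (conjT : GalT F) conjT_mul_self = 0 :=
  Census.HalfParity.halfRank_eq_zero_of_hTwo_eq_zero conjT conjT_mul_self conjT_ne_one h

/-- **THE SANDWICH for `F`**: `β(F) + t(F) ≤ φ₂(F) + 1 + δ(F) ≤ |𝒮| + 1 + δ(F)` for every `hgen` set `𝒮`, and `t(F) ≤ (1 + δ(F))·h(F)`.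
[folklore] -/
theorem sandwich_of_hgen [IsCMField F] [IsGalois ℚ F] (T₀ : CMF (GalT F) conjT) (𝒮 : Finset (Face F)) (σ₀ : F →+* ℂ)
    (hgen : ∀ f : Face F, lefChar f.corner (fun _ => ({σ₀} : Finset (F →+* ℂ))) ∈ AddSubgroup.closure
      {a : Asym F | ∃ g ∈ (𝒮 : Set (Face F)), ∃ σ : F →+* ℂ, a = lefChar g.corner (fun _ => ({σ} : Finset (F →+* ℂ)))}) :
    Fintype.card (Block (conjT : GalT F)) + halfRank (conjT : GalT F) conjT_mul_self ≤
        fibreTwo (conjT : GalT F) conjT_mul_self + 1 + wdelta (conjT : GalT F) T₀ ∧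
      fibreTwo (conjT : GalT F) conjT_mul_self ≤ 𝒮.card ∧
      halfRank (conjT : GalT F) conjT_mul_self ≤ (1 + wdelta (conjT : GalT F) T₀) * hTwo (conjT : GalT F) :=
  ⟨card_block_add_halfRank_le_fibreTwo_add T₀, FaceCoinvariant.fibreTwo_le_card_of_hgen 𝒮 σ₀ hgen, halfRank_le_hTwo T₀⟩

end Summit.HodgeConjecture.CorCM.FaceHalfParity

end
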